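import Summits.QuantumFields.YangMills.Theorems.BalabanLadderNTSkewResponse
import Summits.QuantumFields.YangMills.Theorems.BalabanLadderNTReferenceTorusSigned
import HarnessLib

/-!
# Crux `NT` (stmt-QuantumFields-19353): skew response, III — the card's two-point Transfer `C⁺` in the REGISTERED
# currency: a two-point DROP under a local weakening of the coupling on ONE torus per coupling gives `NT`

Helper file (`--supports stmt-QuantumFields-19353`) of the fleet lead prover of crux `NT` (unit `ym-spine-19353-p1`,
g5).  Files I–II (`…NTSkewResponseTilt.lean`, `…NTSkewResponse.lean`) landed the exact identity
`Q3 = d/dt|₀ Q2^{(t·h)}` and the transfer `ModulatedResponseFloor ⇒ SignedSkewness` of the crux idea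
`Cruxes/NT/Ideas/skewness-from-asymptotic-freedom.md` in its `∀ L` form; `…NTReferenceTorusSigned.lean` carries a
SIGNED three-point floor from ONE torus per coupling to all tori.  This file composes the two in the currency of
the skeleton of record v4T (`stub_refpkgT : RefPkgT`):

* `q3_le_of_modulatedResponse_at` — POINTWISE (one `β`, one torus, one spacing): if the modulated two-point
  function drops at rate `e`, `Q2^{(t·h)}(f,g) − Q2(f,g) ≤ −e·t` for `t ∈ (0, t₀]`, then `Q3(f,g,h) ≤ −e`;
* `nt_of_torusReferencePackage_modulated` — **`BalabanLadder.NT` BY NAME** from: units, E1/E2/E3-osc, the two-point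
  floor (R2) of `RefPkgT` verbatim, and — in place of the three-point floor (R3) — the card's TWO-POINT response
  floor with the per-triple transfer margin on ONE torus `2L₀(β)+1` per coupling:
  `Q2^{(t·h)}_{β,L₀(β)}(f,g) − Q2_{β,L₀(β)}(f,g) ≤ −(ε + margin)·t` for `t ∈ (0, t₀(β)]`.
  So an engine may discharge BOTH floors of `RefPkgT` in two-point currency (the second for a Wilson measure with a
  smoothly site-modulated coupling near `supp h`, sign known in advance: weakening the coupling near `supp h` LOWERS
  the `f,g` two-point function, the card's `b₀ > 0` mechanism).

Refs: card `Cruxes/NT/Ideas/skewness-from-asymptotic-freedom.md` §Transfer, §5; files `…NTSkewResponse.lean`,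
`…NTReferenceTorusSigned.lean`, `…NTReferenceTorusPackage.lean`.
-/

set_option autoImplicit false

noncomputable section

open scoped SchwartzMap
open MeasureTheory Filter Topology
open Literature.MathematicalPhysics.QuantumFieldTheory Literature.MathematicalPhysics.QuantumLattice
open Literature.Probability.LatticeModels
open Summit.QuantumFields.YangMills.Cruxes.OSLegsFromFemtoAndGap.DlrCollarTransfer

namespace Summit.QuantumFields.YangMills.Cruxes.NT.SkewResponse

section Pointwise

variable (G : Type) [Group G] [TopologicalSpace G] [IsTopologicalGroup G] [CompactSpace G]
  [MeasurableSpace G] [BorelSpace G] (r : LatticeRep G)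

/-- **Pointwise two-point ⇒ signed three-point.**  At one coupling `β`, one torus `2L+1`, one spacing `s`: if the
smeared truncated two-point function of `f, g` under Wilson's measure tilted by `t · Σ_z h(s z) dens_z` drops at
rate `e` for `t ∈ (0, t₀]`, then `Q3_{β,L,s}(f, g, h) ≤ −e` (identity `hasDerivAt_tiltedQ2` + one-sided slope lemma).
[folklore] -/
theorem q3_le_of_modulatedResponse_at (β : ℝ) (L : ℕ) (s : ℝ) (h f g : 𝓢(EuclideanSpace ℝ (Fin 4), ℝ))
    {e t₀ : ℝ} (ht₀ : 0 < t₀)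
    (hdrop : ∀ t : ℝ, 0 < t → t ≤ t₀ →
      (∑ x ∈ box 4 L, ∑ y ∈ box 4 L, f (s • siteToE x) * g (s • siteToE y) *
          ((∫ U, dens G r x (torusLift (2 * L + 1) U) * dens G r y (torusLift (2 * L + 1) U)
              ∂(wilsonMeasure (d := 4) (L := 2 * L + 1) r.ρ β).tilted fun U =>
                t * ∑ z ∈ box 4 L, h (s • siteToE z) * dens G r z (torusLift (2 * L + 1) U)) -
            (∫ U, dens G r x (torusLift (2 * L + 1) U)
              ∂(wilsonMeasure (d := 4) (L := 2 * L + 1) r.ρ β).tilted fun U =>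
                t * ∑ z ∈ box 4 L, h (s • siteToE z) * dens G r z (torusLift (2 * L + 1) U)) *
            (∫ U, dens G r y (torusLift (2 * L + 1) U)
              ∂(wilsonMeasure (d := 4) (L := 2 * L + 1) r.ρ β).tilted fun U =>
                t * ∑ z ∈ box 4 L, h (s • siteToE z) * dens G r z (torusLift (2 * L + 1) U)))) -
        Q2 G r β L s f g ≤ -e * t) :
    Q3 G r β L s f g h ≤ -e := by
  have hD := hasDerivAt_tiltedQ2 G r β L s h f g
  have h0 := tiltedQ2_zero G r β L s h f g
  exact deriv_le_of_increment_le (c := -e) ht₀ hD (fun t ht htt => by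
    have hb := hdrop t ht htt
    rw [← h0] at hb
    simpa only using hb)

end Pointwise

/-- **The crux `BalabanLadder.NT` BY NAME from the periodic reference package with the three-point floor in
TWO-POINT RESPONSE currency**: for every compact simple `G` (Borel σ-algebra) one `(r, a)` (`0 < a`, `a → 0`),
constants `C₁, C₂, C₃ ≥ 0`, a femto scale `ℓ`, support radius `σ > 0`, collar `κ > 0` (`2(σ+κ) < ℓ`), the three
exterior-oscillation ceilings E1/E2/E3-osc on femto cubes, the two-point floor (R2) with margin on ONE torus per
coupling (verbatim as in `RefPkgT`), and (R3-mod): three test functions with pairwise disjoint supports in the ball of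
radius `σ`, `ε > 0`, and for every `β ≥ β₅` ONE torus `2L₀(β)+1` (`a β · L₀(β) ≥ σ + κ + 1`) and a `t₀ > 0` such that
for `t ∈ (0, t₀]` the modulated two-point function of `f, g` (Wilson's measure tilted by `t · Σ_z h(aβ z) dens_z`) lies
below `Q2(f, g)` by at least `(ε + per-triple transfer margin) · t`. [folklore] -/
theorem nt_of_torusReferencePackage_modulated
    (hP : ∀ (G : Type) [Group G] [TopologicalSpace G] [IsTopologicalGroup G] [CompactSpace G],
      IsCompactSimpleLieGroup G → letI : MeasurableSpace G := borel G; haveI : BorelSpace G := ⟨rfl⟩;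
      ∃ (r : LatticeRep G) (a : ℝ → ℝ), (∀ β, 0 < a β) ∧ Tendsto a atTop (𝓝 0) ∧
      ∃ (C₁ C₂ C₃ ℓ σ κ : ℝ), 0 ≤ C₁ ∧ 0 ≤ C₂ ∧ 0 ≤ C₃ ∧ 0 < σ ∧ 0 < κ ∧ 2 * (σ + κ) < ℓ ∧
      (∃ β₁ : ℝ, ∀ β : ℝ, β₁ ≤ β → ∀ (c : Fin 4 → ℤ) (b : ℕ), (b : ℝ) * a β ≤ ℓ →
        ∀ (η η' : LGConfig 4 G) (x : Fin 4 → ℤ), 1 ≤ depth c b x →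
          |kerE G r β c b η (dens G r x) - kerE G r β c b η' (dens G r x)| ≤ C₁ / (depth c b x : ℝ) ^ 4) ∧
      (∃ β₂ : ℝ, ∀ β : ℝ, β₂ ≤ β → ∀ (c : Fin 4 → ℤ) (b : ℕ), (b : ℝ) * a β ≤ ℓ →
        ∀ (η η' : LGConfig 4 G) (x y : Fin 4 → ℤ), 1 ≤ depth c b x → 1 ≤ depth c b y →
          |kerCov G r β c b η (dens G r x) (dens G r y) - kerCov G r β c b η' (dens G r x) (dens G r y)| ≤
            C₂ / ((min (depth c b x) (depth c b y) : ℕ) : ℝ) ^ 4 / (1 + ‖siteToE (y - x)‖) ^ 4) ∧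
      (∃ β₃ : ℝ, ∀ β : ℝ, β₃ ≤ β → ∀ (c : Fin 4 → ℤ) (b : ℕ), (b : ℝ) * a β ≤ ℓ →
        ∀ (η η' : LGConfig 4 G) (x y z : Fin 4 → ℤ), 1 ≤ depth c b x → 1 ≤ depth c b y → 1 ≤ depth c b z →
          |kerK3 G r β c b η x y z - kerK3 G r β c b η' x y z| ≤
            C₃ / ((min (min (depth c b x) (depth c b y)) (depth c b z) : ℕ) : ℝ) ^ 4 /
              (1 + min (min ‖siteToE (y - x)‖ ‖siteToE (z - y)‖) ‖siteToE (z - x)‖) ^ 8) ∧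
      (∃ (v : 𝓢(EuclideanSpace ℝ (Fin 4), ℝ)) (ε β₅ : ℝ) (L₀ : ℝ → ℕ),
        tsupport (v : EuclideanSpace ℝ (Fin 4) → ℝ) ⊆ {y | 0 < y 0} ∧
        tsupport (v : EuclideanSpace ℝ (Fin 4) → ℝ) ⊆ Metric.closedBall 0 σ ∧ 0 < ε ∧
        ∀ β : ℝ, β₅ ≤ β → σ + κ + 1 ≤ a β * L₀ β ∧
          ε + 2 * (C₁ * (a β / κ) ^ 4 * ∑ x ∈ box 4 (L₀ β), |thetaTest 4 v (a β • siteToE x)|) *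
                (C₁ * (a β / κ) ^ 4 * ∑ y ∈ box 4 (L₀ β), |v (a β • siteToE y)|) +
              C₂ * (a β / κ) ^ 4 * ∑ x ∈ box 4 (L₀ β), ∑ y ∈ box 4 (L₀ β),
                |thetaTest 4 v (a β • siteToE x)| * |v (a β • siteToE y)| / (1 + ‖siteToE (y - x)‖) ^ 4 ≤
            Q2 G r β (L₀ β) (a β) (thetaTest 4 v) v) ∧
      (∃ (f g h : 𝓢(EuclideanSpace ℝ (Fin 4), ℝ)) (ε β₅ : ℝ) (L₀ : ℝ → ℕ),
        Disjoint (tsupport (f : EuclideanSpace ℝ (Fin 4) → ℝ)) (tsupport (g : EuclideanSpace ℝ (Fin 4) → ℝ)) ∧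
        Disjoint (tsupport (g : EuclideanSpace ℝ (Fin 4) → ℝ)) (tsupport (h : EuclideanSpace ℝ (Fin 4) → ℝ)) ∧
        Disjoint (tsupport (f : EuclideanSpace ℝ (Fin 4) → ℝ)) (tsupport (h : EuclideanSpace ℝ (Fin 4) → ℝ)) ∧
        tsupport (f : EuclideanSpace ℝ (Fin 4) → ℝ) ⊆ Metric.closedBall 0 σ ∧
        tsupport (g : EuclideanSpace ℝ (Fin 4) → ℝ) ⊆ Metric.closedBall 0 σ ∧
        tsupport (h : EuclideanSpace ℝ (Fin 4) → ℝ) ⊆ Metric.closedBall 0 σ ∧ 0 < ε ∧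
        ∀ β : ℝ, β₅ ≤ β → σ + κ + 1 ≤ a β * L₀ β ∧ ∃ t₀ : ℝ, 0 < t₀ ∧ ∀ t : ℝ, 0 < t → t ≤ t₀ →
          (∑ x ∈ box 4 (L₀ β), ∑ y ∈ box 4 (L₀ β), f (a β • siteToE x) * g (a β • siteToE y) *
              ((∫ U, dens G r x (torusLift (2 * L₀ β + 1) U) * dens G r y (torusLift (2 * L₀ β + 1) U)
                  ∂(wilsonMeasure (d := 4) (L := 2 * L₀ β + 1) r.ρ β).tilted fun U =>
                    t * ∑ z ∈ box 4 (L₀ β), h (a β • siteToE z) * dens G r z (torusLift (2 * L₀ β + 1) U)) -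
                (∫ U, dens G r x (torusLift (2 * L₀ β + 1) U)
                  ∂(wilsonMeasure (d := 4) (L := 2 * L₀ β + 1) r.ρ β).tilted fun U =>
                    t * ∑ z ∈ box 4 (L₀ β), h (a β • siteToE z) * dens G r z (torusLift (2 * L₀ β + 1) U)) *
                (∫ U, dens G r y (torusLift (2 * L₀ β + 1) U)
                  ∂(wilsonMeasure (d := 4) (L := 2 * L₀ β + 1) r.ρ β).tilted fun U =>
                    t * ∑ z ∈ box 4 (L₀ β), h (a β • siteToE z) * dens G r z (torusLift (2 * L₀ β + 1) U)))) -
            Q2 G r β (L₀ β) (a β) f g ≤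
          -(ε + ∑ x ∈ box 4 (L₀ β), ∑ y ∈ box 4 (L₀ β), ∑ z ∈ box 4 (L₀ β),
              |f (a β • siteToE x)| * |g (a β • siteToE y)| * |h (a β • siteToE z)| *
                (2 * ((C₁ * (a β / κ) ^ 4) * (C₂ * (a β / κ) ^ 4 / (1 + ‖siteToE (z - y)‖) ^ 4) +
                      (C₁ * (a β / κ) ^ 4) * (C₂ * (a β / κ) ^ 4 / (1 + ‖siteToE (z - x)‖) ^ 4) +
                      (C₁ * (a β / κ) ^ 4) * (C₂ * (a β / κ) ^ 4 / (1 + ‖siteToE (y - x)‖) ^ 4) +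
                      (C₁ * (a β / κ) ^ 4) * (C₁ * (a β / κ) ^ 4) * (C₁ * (a β / κ) ^ 4)) +
                  C₃ * (a β / κ) ^ 4 /
                    (1 + min (min ‖siteToE (y - x)‖ ‖siteToE (z - y)‖) ‖siteToE (z - x)‖) ^ 8)) * t)) :
    Summit.QuantumFields.YangMills.Theses.BalabanLadder.NT := by
  refine Reference.nt_of_torusReferencePackage_signed fun G _ _ _ _ hG => ?_
  letI : MeasurableSpace G := borel G
  haveI : BorelSpace G := ⟨rfl⟩
  obtain ⟨r, a, ha₀, ha, C₁, C₂, C₃, ℓ, σ, κ, hC₁, hC₂, hC₃, hσ, hκ, hℓ, hE1, hE2, hE3, hR2, hR3m⟩ := hP G hG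
  refine ⟨r, a, ha₀, ha, C₁, C₂, C₃, ℓ, σ, κ, hC₁, hC₂, hC₃, hσ, hκ, hℓ, hE1, hE2, hE3, hR2, ?_⟩
  obtain ⟨f, g, h, ε, β₅, L₀, hfg, hgh, hfh, hfσ, hgσ, hhσ, hε, HR⟩ := hR3m
  refine ⟨f, g, h, ε, β₅, L₀, hfg, hgh, hfh, hfσ, hgσ, hhσ, hε, fun β hβ => ?_⟩
  obtain ⟨hL₀, t₀, ht₀, hdrop⟩ := HR β hβ
  exact ⟨hL₀, q3_le_of_modulatedResponse_at G r β (L₀ β) (a β) h f g ht₀ hdrop⟩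

end Summit.QuantumFields.YangMills.Cruxes.NT.SkewResponse

end
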